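import Mathlib
import Summits.PneNP.PneNP.Theorems.PstarGraphQuadGapInstance

/-!
# The gap-lemma crux implies the graph-quadratic gap conjecture (ROUND-24 item T24.11b, `ReductionToPstar` by name)

FRONTIER range-avoidance ladder (cell `pnp-ideate`, ROUND-24 gap-lemma programme; restricted-model combinatorics — nothing here bears
on `P` versus `NP`).

**Theorem** `reductionToPstar : PstarGraphQuadGap.ReductionToPstar`, i.e. `PstarGapLemmaSO → GraphQuadGap` (with `K(Δ) = K_SO(Δ + 1)`:
the XOR variables of the built instance have degree `1`, its AND variables degree `≤ Δ`).  For a simple graph `E` of maximum degree `Δ`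
and a graph-quadratic system `W` supported on `E`, take the instance `PstarGraphQuadGapInstance.inst E` (output `j` = `x_j ⊕ x'_j ⊕ a_p a_q`
for the `j`-th edge `(p,q)`; pure, typed, simple overlaps, `MaxDegree (Δ+1)`, boundary expanding at every radius) with target `y = 0`,
and LIFT each constraint `(T, S, c)` to the parity constraint `(⋃_{edge j ∈ T} {x_j, x'_j} ∪ a''S, c)` (`liftW`, at most `#W` constraints).
* `parity_liftSet`: the lifted parity is `⊕_{edge j ∈ T} (x_j ⊕ x'_j) ⊕ ⊕_{v ∈ S} a_v`;
* `not_feasible_univ`: if every output vanishes then `x_j ⊕ x'_j = a_p a_q`, so the lifted system holds iff `W` holds at `a = z ∘ av` —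
  impossible when `W` is unsat;
* `feasible_erase`: the edge-minimality witness `a` for the `j₀`-th edge lifts to `x_j := a_p a_q` (`j ≠ j₀`), `x_{j₀} := ¬(a_p a_q)`,
  `x' := 0`, which satisfies every lifted constraint (the flipped bit sits exactly in the constraints with `edge j₀ ∈ T`, the ones `a`
  violates) and every output except `j₀`.
Hence `univ` is minimal infeasible, and `GapBound K m` at radius `m = #E` gives `#E ≤ K·#liftW ≤ K·#W`.  So a counterexample to
`GraphQuadGap` (the XOR-disjoint, purely algebraic core) would refute the crux `PstarGapLemmaSO`.
-/

set_option linter.dupNamespace false -- `Summit.PneNP.PneNP.…`: summit = sub-problem name (D-0017 single-conjunct layout)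

open Finset Literature.Computability.Complexity
open Summit.PneNP.PneNP.Theorems.PstarPDT (parity)
open Summit.PneNP.PneNP.Theorems.PstarGapLemma (Sat Feasible MinInfeasible GapBound MaxDegree PstarGapLemmaSO)
open Summit.PneNP.PneNP.Theorems.PstarGraphQuadGap (Edge QCon qval QHolds Simple EdgeMaxDegree Supported Unsat EdgeMinimal
  GraphQuadGap ReductionToPstar)
open Summit.PneNP.PneNP.Theorems.PstarGraphQuadGapInstance

namespace Summit.PneNP.PneNP.Theorems.PstarGraphQuadGapReduction

variable {V : ℕ} (E : Finset (Edge V))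

/-! ## Lifting the constraints -/

/-- The outputs whose edge lies in `T`. -/
noncomputable def idxSet (T : Finset (Edge V)) : Finset (Fin E.card) := univ.filter fun j => edge E j ∈ T

/-- The variable set of the lifted constraint: both XOR variables of every output with edge in `T`, and the AND variables of `S`. -/
noncomputable def liftSet (w : QCon V) : Finset (Fin (E.card + E.card + V)) :=
  (idxSet E w.1).biUnion (fun j => {xv E j, xv' E j}) ∪ w.2.1.map (avEmb E)

/-- The lifted parity constraint. -/
noncomputable def lift (w : QCon V) : Finset (Fin (E.card + E.card + V)) × Bool := (liftSet E w, w.2.2)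

/-- The lifted system. -/
noncomputable def liftW (W : Finset (QCon V)) : Finset (Finset (Fin (E.card + E.card + V)) × Bool) := W.image (lift E)

/-- At most `#W` lifted constraints. -/
theorem card_liftW_le (W : Finset (QCon V)) : (liftW E W).card ≤ W.card := card_image_le

/-- Satisfying the lifted system, constraint by constraint. -/
theorem sat_liftW_iff (W : Finset (QCon V)) (z : Fin (E.card + E.card + V) → Bool) :
    Sat (liftW E W) z ↔ ∀ w ∈ W, parity (liftSet E w) z = w.2.2 := by
  unfold PstarGapLemma.Sat liftW
  constructor
  · intro h w hw
    exact h (lift E w) (mem_image_of_mem _ hw)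
  · intro h e he
    obtain ⟨w, hw, rfl⟩ := mem_image.1 he
    exact h w hw

/-- **The lifted parity**: `⊕_{edge j ∈ T} (x_j ⊕ x'_j) ⊕ ⊕_{v ∈ S} a_v`. -/
theorem parity_liftSet (w : QCon V) (z : Fin (E.card + E.card + V) → Bool) :
    parity (liftSet E w) z =
      xor (bpar (idxSet E w.1) (fun j => xor (z (xv E j)) (z (xv' E j)))) (parity w.2.1 (fun v => z (av E v))) := by
  have hne : ∀ j : Fin E.card, xv E j ≠ xv' E j := fun j h => by
    have := congrArg Fin.val h; rw [xv_val, xv'_val] at this; omega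
  have hdis : ∀ j j' : Fin E.card, j ≠ j' → Disjoint ({xv E j, xv' E j} : Finset _) {xv E j', xv' E j'} := by
    intro j j' hjj'
    rw [disjoint_left]
    intro w hw hw'
    rw [mem_insert, mem_singleton] at hw hw'
    have h1 := j.isLt
    have h2 := j'.isLt
    rcases hw with rfl | rfl <;> rcases hw' with h | h
    · exact hjj' (xv_injective E h)
    · have := congrArg Fin.val h; rw [xv_val, xv'_val] at this; omega
    · have := congrArg Fin.val h; rw [xv_val, xv'_val] at this; omega
    · exact hjj' (xv'_injective E h)
  have hdisj : Disjoint ((idxSet E w.1).biUnion fun j => ({xv E j, xv' E j} : Finset _)) (w.2.1.map (avEmb E)) := by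
    rw [disjoint_left]
    intro u hu hu'
    rw [mem_biUnion] at hu
    obtain ⟨j, -, hj⟩ := hu
    rw [mem_map] at hu'
    obtain ⟨v, -, hv⟩ := hu'
    have h1 := j.isLt
    have hvv : (avEmb E v).val = E.card + E.card + v.val := rfl
    rw [mem_insert, mem_singleton] at hj
    rcases hj with rfl | rfl
    · have := congrArg Fin.val hv; rw [hvv, xv_val] at this; omega
    · have := congrArg Fin.val hv; rw [hvv, xv'_val] at this; omega
  rw [parity_eq_bpar, liftSet, bpar_union hdisj, bpar_biUnion_pair (xv E) (xv' E) hne hdis, bpar_map, parity_eq_bpar]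
  rfl

/-- The quadratic part of `qval` as a `bpar`. -/
theorem quad_eq_bpar (T : Finset (Edge V)) (a : Fin V → Bool) :
    decide (Odd (T.filter fun e => a e.1 = true ∧ a e.2 = true).card) = bpar T (fun e => a e.1 && a e.2) := by
  unfold bpar
  have h : (T.filter fun e => a e.1 = true ∧ a e.2 = true) = T.filter fun e => (a e.1 && a e.2) = true :=
    filter_congr fun e _ => by rw [Bool.and_eq_true]
  rw [h]

/-- `qval` as lifted-style parities. -/
theorem qval_eq (w : QCon V) (a : Fin V → Bool) :
    qval w a = xor (bpar w.1 (fun e => a e.1 && a e.2)) (parity w.2.1 a) := by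
  unfold PstarGraphQuadGap.qval
  rw [quad_eq_bpar]

/-- Transfer along the edge enumeration: for `T ⊆ E`, `⊕_{edge j ∈ T} g (edge j) = ⊕_{e ∈ T} g e`. -/
theorem bpar_idxSet {T : Finset (Edge V)} (hT : T ⊆ E) (g : Edge V → Bool) :
    bpar (idxSet E T) (fun j => g (edge E j)) = bpar T g := by
  unfold bpar
  have h : ((idxSet E T).filter fun j => g (edge E j) = true).map ⟨edge E, edge_injective E⟩ = T.filter fun e => g e = true := by
    ext e
    rw [mem_map, mem_filter]
    constructor
    · rintro ⟨j, hj, rfl⟩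
      rw [mem_filter, idxSet, mem_filter] at hj
      exact ⟨hj.1.2, hj.2⟩
    · rintro ⟨he, hg⟩
      obtain ⟨j, hj⟩ := exists_edge_eq E (hT he)
      refine ⟨j, mem_filter.2 ⟨by rw [idxSet, mem_filter, hj]; exact ⟨mem_univ _, he⟩, by rw [hj]; exact hg⟩, hj⟩
  rw [← h, card_map]

/-! ## Semantics: `univ` is minimal infeasible -/

/-- The value of output `j`. -/
theorem eval_inst (hS : Simple E) (z : Fin (E.card + E.card + V) → Bool) (j : Fin E.card) :
    (inst E).eval z j = xor (xor (z (xv E j)) (z (xv' E j))) (z (av E (edge E j).1) && z (av E (edge E j).2)) := by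
  have := hS
  rfl

variable {E}

/-- **If every output vanishes, the lifted system is `W` at `a = z ∘ av`; so `Unsat W` makes `univ` infeasible.** -/
theorem not_feasible_univ (hS : Simple E) {W : Finset (QCon V)} (hsup : Supported E W) (hu : Unsat W) :
    ¬ Feasible (inst E) (fun _ => false) (liftW E W) univ := by
  rintro ⟨z, hsat, hzero⟩
  apply hu
  refine ⟨fun v => z (av E v), fun w hw => ?_⟩
  have hx : ∀ j : Fin E.card, xor (z (xv E j)) (z (xv' E j)) = (z (av E (edge E j).1) && z (av E (edge E j).2)) := by
    intro j
    have h : (inst E).eval z j = false := hzero j (mem_univ _)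
    rw [eval_inst E hS] at h
    revert h
    cases z (xv E j) <;> cases z (xv' E j) <;> cases (z (av E (edge E j).1) && z (av E (edge E j).2)) <;> decide
  have hp := (sat_liftW_iff E W z).1 hsat w hw
  rw [parity_liftSet, bpar_congr (fun j _ => hx j),
    bpar_idxSet E (hsup w hw) (fun e => z (av E e.1) && z (av E e.2))] at hp
  unfold PstarGraphQuadGap.QHolds
  rw [qval_eq]
  exact hp

/-- **Every output is necessary**: the edge-minimality witness lifts to an assignment satisfying the lifted system and all outputs
but `j₀`. -/
theorem feasible_erase (hS : Simple E) {W : Finset (QCon V)} (hsup : Supported E W) (hmin : EdgeMinimal E W) (j₀ : Fin E.card) :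
    Feasible (inst E) (fun _ => false) (liftW E W) (univ.erase j₀) := by
  obtain ⟨a, ha⟩ := hmin (edge E j₀) (edge_mem E j₀)
  let prod : Fin E.card → Bool := fun j => a (edge E j).1 && a (edge E j).2
  let gx : Fin E.card → Bool := fun j => if j = j₀ then !prod j else prod j
  let z : Fin (E.card + E.card + V) → Bool := Fin.append (Fin.append gx fun _ => false) a
  have zx : ∀ j, z (xv E j) = gx j := fun j => by
    show Fin.append (Fin.append gx fun _ => false) a (Fin.castAdd V (Fin.castAdd E.card j)) = gx j
    rw [Fin.append_left, Fin.append_left]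
  have zx' : ∀ j, z (xv' E j) = false := fun j => by
    show Fin.append (Fin.append gx fun _ => false) a (Fin.castAdd V (Fin.natAdd E.card j)) = false
    rw [Fin.append_left, Fin.append_right]
  have za : ∀ v, z (av E v) = a v := fun v => by
    show Fin.append (Fin.append gx fun _ => false) a (Fin.natAdd (E.card + E.card) v) = a v
    rw [Fin.append_right]
  refine ⟨z, ?_, ?_⟩
  · -- the lifted system
    rw [sat_liftW_iff]
    intro w hw
    rw [parity_liftSet]
    simp only [zx, zx', za, Bool.xor_false]
    have hq := ha w hw
    unfold PstarGraphQuadGap.QHolds at hq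
    rw [qval_eq] at hq
    by_cases hj : edge E j₀ ∈ w.1
    · -- the flipped bit is inside: the lifted parity is the negated quadratic value, and `a` violates `w`
      have hmem : j₀ ∈ idxSet E w.1 := by rw [idxSet, mem_filter]; exact ⟨mem_univ _, hj⟩
      have hflip : bpar (idxSet E w.1) gx = !bpar (idxSet E w.1) prod :=
        bpar_flip hmem (by simp [gx]) (fun j _ hne => by simp [gx, hne])
      rw [show (fun j => gx j) = gx from rfl, hflip, bpar_idxSet E (hsup w hw) (fun e => a e.1 && a e.2)]
      have hne : xor (bpar w.1 fun e => a e.1 && a e.2) (parity w.2.1 a) ≠ w.2.2 := fun h => (hq.1 h) hj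
      revert hne
      cases bpar w.1 (fun e => a e.1 && a e.2) <;> cases parity w.2.1 a <;> cases w.2.2 <;> decide
    · -- the flipped bit is outside: the lifted parity is the quadratic value, and `a` satisfies `w`
      have hcongr : bpar (idxSet E w.1) gx = bpar (idxSet E w.1) prod :=
        bpar_congr fun j hjm => by
          have : j ≠ j₀ := fun h => hj (by rw [← h]; exact (mem_filter.1 hjm).2)
          simp [gx, this]
      rw [show (fun j => gx j) = gx from rfl, hcongr, bpar_idxSet E (hsup w hw) (fun e => a e.1 && a e.2)]
      exact hq.2 hj
  · -- all outputs but `j₀` vanish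
    intro j hj
    rw [eval_inst E hS, zx, zx', za, za]
    have hne : j ≠ j₀ := ne_of_mem_erase hj
    simp only [gx, hne, if_false, Bool.xor_false, prod, Bool.xor_self]

/-- **`univ` is a minimal infeasible set of the lifted system** (for unsat, edge-minimal `W` on the simple graph `E`). -/
theorem minInfeasible_univ (hS : Simple E) {W : Finset (QCon V)} (hsup : Supported E W) (hu : Unsat W) (hmin : EdgeMinimal E W) :
    MinInfeasible (inst E) (fun _ => false) (liftW E W) univ :=
  ⟨not_feasible_univ hS hsup hu, fun j₀ _ => feasible_erase hS hsup hmin j₀⟩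

/-! ## The reduction -/

/-- **T24.11b — `ReductionToPstar` by name: the gap-lemma crux implies the graph-quadratic gap conjecture** (`K(Δ) = K_SO(Δ+1)`).
Restricted-model statement of the range-avoidance ladder; it says nothing about `P` versus `NP`. -/
theorem reductionToPstar : ReductionToPstar := by
  intro hSO Δ
  obtain ⟨K, -, hK⟩ := hSO (Δ + 1)
  refine ⟨K, fun V E W hS hΔ hsup hu hmin => ?_⟩
  have hGB : GapBound K E.card (inst E) (fun _ => false) :=
    hK _ _ E.card (inst E) (isPure_inst hS) typed_inst (boundaryExpanding_inst E.card) (simpleOverlap_inst hS)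
      (maxDegree_inst hΔ) (fun _ => false)
  have h := hGB (liftW E W) univ (by rw [card_univ, Fintype.card_fin]) (minInfeasible_univ hS hsup hu hmin)
  rw [card_univ, Fintype.card_fin] at h
  exact h.trans (Nat.mul_le_mul_left _ (card_liftW_le E W))

end Summit.PneNP.PneNP.Theorems.PstarGraphQuadGapReduction
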